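import Summits.QuantumFields.GaugeBoot.GaugeInvariantLineAverages
import Summits.QuantumFields.GaugeBoot.GaugeInvariantBootstrap
import HarnessLib

/-!
# Wilson loops generate the gauge-invariant polynomial observables: the first fundamental theorem for lattice gauge theory (gauge-boot, FFT 8/8)

HONEST FRAMING (cell `pub-gaugeboot`, page 1 of every file): the venture produces certified bounds
on lattice expectations at stated coupling, gauge group, dimension and torus size; NOT a mass gap,
NOT a continuum limit, NOT a string tension; NOT Yang–Mills-summit-bearing (barriers
`FixedCouplingUltralocality`, `PerturbativeInvisibility`). Structural statement about the
observable algebra of lattice gauge theory on the torus `(ℤ/L)^d`; no number is certified.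

## Content (`SU(N) ⊆ ρ(G) ⊆ U(N)`, e.g. the defining representations of `SU(N)` and `U(N)`, `N ≥ 1`)

* `loopAlgebra r x` — the unital real algebra generated by the Wilson loops `Re/Im tr ρ(hol_x w)`
  (`loopRe`, `loopIm`), `w` closed at `x`: the MULTI-TRACE WILSON LOOP ALGEBRA, i.e. the unknowns of
  the Kazakov–Zheng lattice bootstrap (arXiv:2203.11360, arXiv:2404.16925).
* `toComplexCM` (`C(U, ℝ) → C(U, ℂ)`), `reCM` / `imCM`; `toComplexCM_mem_polyAlgebraC`,
  `reCM_mem_loopAlgebra` (real parts of multi-trace complex loops are real multi-trace loops).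
* ★★★ `mem_loopAlgebra_of_isGaugeInvariant`, `isGaugeInvariant_iff_mem_loopAlgebra` — THE FIRST
  FUNDAMENTAL THEOREM FOR LATTICE GAUGE INVARIANTS (Durhuus 1980; Sengupta 1994, Thm. 2; Weyl):
  a polynomial observable in the link variables (the tree's `polyAlgebra r`) is gauge invariant
  IF AND ONLY IF it is a polynomial in the Wilson loops at the base point. Instances
  `…_suN`, `…_uN`.
* ★★ `gaugeAvgL_mem_loopAlgebra` — the gauge average of EVERY polynomial observable (e.g. of a
  product of open Wilson lines) is a polynomial in Wilson loops: the structure behind the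
  multi-trace loop equations and positivity matrices of Kazakov–Zheng 2024 §2.3/§3.1.
* ★★ `loopAlgebra_eq_adjoin_allLoops` — the base point is immaterial; ★★★
  `eq_of_eqOn_singleLoops_su2` — for `SU(2)`: two linear functionals agreeing on `1` and on the
  SINGLE-trace Wilson loops at one base point agree on every gauge-invariant polynomial observable
  (with the lane's `eqOn_adjoin_loops_of_eqOn_single_su2`), so the `SU(2)` bootstrap may be written
  on single-trace data (Kazakov–Zheng 2022 §5).

What is NOT claimed: nothing about infinite volume, the continuum, or values of Weingarten
functions; `SU(N)`-only invariants with `N ∤ (#U − #Ū)` do not occur for polynomial FUNCTIONS on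
the group (they are loops in disguise — the theorem covers `SU(N)` verbatim).

References: B. Durhuus, *On the structure of gauge invariant classical observables in lattice
gauge theories*, Lett. Math. Phys. 4 (1980) 515–522; A. Sengupta, *Gauge invariant functions of
connections*, Proc. AMS 121 (1994) 897–905; H. Weyl, *The Classical Groups* (1939).
-/

noncomputable section

namespace Summit.QuantumFields.GaugeBoot

open MeasureTheory Matrix Finset TensorFFT
open scoped ComplexConjugate
open Literature.MathematicalPhysics.QuantumFieldTheory (Site Edge GaugeConfig LatticeRep gaugeTransform
  IsGaugeInvariant haarProbability)
open Literature.MathematicalPhysics.QuantumLattice (fundamentalLatticeRep unitaryFundamentalLatticeRep)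

variable {d L : ℕ} {G : Type*} [Group G] [TopologicalSpace G] [IsTopologicalGroup G] (r : LatticeRep G)

/-! ## The real multi-trace Wilson loop algebra -/

/-- **The (real, multi-trace) Wilson loop algebra at `x`**: the unital `ℝ`-subalgebra of the
observables generated by `Re tr ρ(hol_x w)` and `Im tr ρ(hol_x w)`, `w` closed at `x`. [folklore] -/
def loopAlgebra (x : Site d L) : Subalgebra ℝ C(GaugeConfig d L G, ℝ) :=
  Algebra.adjoin ℝ {f | ∃ w : Word d, Word.endpoint x w = x ∧ (f = loopRe r x w ∨ f = loopIm r x w)}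

/-- Wilson loops are in the loop algebra (real part). -/
theorem loopRe_mem_loopAlgebra (x : Site d L) {w : Word d} (hw : Word.endpoint x w = x) :
    loopRe r x w ∈ loopAlgebra (d := d) (L := L) r x :=
  Algebra.subset_adjoin ⟨w, hw, Or.inl rfl⟩

/-- Wilson loops are in the loop algebra (imaginary part). -/
theorem loopIm_mem_loopAlgebra (x : Site d L) {w : Word d} (hw : Word.endpoint x w = x) :
    loopIm r x w ∈ loopAlgebra (d := d) (L := L) r x :=
  Algebra.subset_adjoin ⟨w, hw, Or.inr rfl⟩

/-- ★ **The loop algebra consists of gauge-invariant polynomial observables** (the easy half). -/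
theorem loopAlgebra_le (x : Site d L) {f : C(GaugeConfig d L G, ℝ)} (hf : f ∈ loopAlgebra (d := d) (L := L) r x) :
    f ∈ polyAlgebra (ι := Edge d L) r ∧ IsGaugeInvariant (⇑f) := by
  induction hf using Algebra.adjoin_induction with
  | mem f hf =>
    obtain ⟨w, hw, rfl | rfl⟩ := hf
    · exact ⟨loopRe_mem r x w, isGaugeInvariant_loopRe r x hw⟩
    · exact ⟨loopIm_mem r x w, isGaugeInvariant_loopIm r x hw⟩
  | algebraMap c => exact ⟨Subalgebra.algebraMap_mem _ c, fun γ U => rfl⟩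
  | add f g _ _ ihf ihg =>
    exact ⟨Subalgebra.add_mem _ ihf.1 ihg.1, fun γ U => by
      simp only [ContinuousMap.add_apply, ihf.2 γ U, ihg.2 γ U]⟩
  | mul f g _ _ ihf ihg =>
    exact ⟨Subalgebra.mul_mem _ ihf.1 ihg.1, fun γ U => by
      simp only [ContinuousMap.mul_apply, ihf.2 γ U, ihg.2 γ U]⟩

/-! ## Real and complex observables -/

/-- A real observable as a complex one. [folklore] -/
def toComplexCM : C(GaugeConfig d L G, ℝ) →ₐ[ℝ] C(GaugeConfig d L G, ℂ) :=
  Complex.ofRealAm.compLeftContinuous ℝ Complex.continuous_ofReal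

omit [Group G] [IsTopologicalGroup G] in
/-- `toComplexCM` evaluated. -/
@[simp] theorem toComplexCM_apply (f : C(GaugeConfig d L G, ℝ)) (U : GaugeConfig d L G) :
    toComplexCM f U = (f U : ℂ) := rfl

/-- Real part of a complex observable. [folklore] -/
def reCM (F : C(GaugeConfig d L G, ℂ)) : C(GaugeConfig d L G, ℝ) :=
  ⟨fun U => (F U).re, Complex.continuous_re.comp F.continuous⟩

/-- Imaginary part of a complex observable. [folklore] -/
def imCM (F : C(GaugeConfig d L G, ℂ)) : C(GaugeConfig d L G, ℝ) :=
  ⟨fun U => (F U).im, Complex.continuous_im.comp F.continuous⟩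

omit [Group G] [IsTopologicalGroup G] in
/-- `reCM` evaluated. -/
@[simp] theorem reCM_apply (F : C(GaugeConfig d L G, ℂ)) (U : GaugeConfig d L G) : reCM F U = (F U).re := rfl

omit [Group G] [IsTopologicalGroup G] in
/-- `imCM` evaluated. -/
@[simp] theorem imCM_apply (F : C(GaugeConfig d L G, ℂ)) (U : GaugeConfig d L G) : imCM F U = (F U).im := rfl

omit [Group G] [IsTopologicalGroup G] in
/-- `reCM (toComplexCM f) = f`. -/
theorem reCM_toComplexCM (f : C(GaugeConfig d L G, ℝ)) : reCM (toComplexCM f) = f := by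
  ext U; simp

omit [IsTopologicalGroup G] in
/-- ★ **Real polynomial observables complexify into complex polynomial observables.** -/
theorem toComplexCM_mem_polyAlgebraC {f : C(GaugeConfig d L G, ℝ)} (hf : f ∈ polyAlgebra (ι := Edge d L) r) :
    toComplexCM f ∈ polyAlgebraC (d := d) (L := L) r := by
  change f ∈ Subalgebra.comap toComplexCM ((polyAlgebraC (d := d) (L := L) r).restrictScalars ℝ)
  refine (Algebra.adjoin_le ?_ : polyAlgebra (ι := Edge d L) r ≤ _) hf
  have hE : ∀ (e : Edge d L) (a b : Fin r.N), entryC r e a b ∈ polyAlgebraC (d := d) (L := L) r :=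
    fun e a b => Algebra.subset_adjoin (Or.inl ⟨e, a, b, rfl⟩)
  have hS : ∀ (e : Edge d L) (a b : Fin r.N), star (entryC r e a b) ∈ polyAlgebraC (d := d) (L := L) r :=
    fun e a b => Algebra.subset_adjoin (Or.inr ⟨e, a, b, rfl⟩)
  rintro g (⟨⟨e, a, b⟩, rfl⟩ | ⟨⟨e, a, b⟩, rfl⟩)
  · have e1 : toComplexCM (reEntry r e a b) =
        ((2 : ℂ)⁻¹ • (entryC r e a b + star (entryC r e a b)) : C(GaugeConfig d L G, ℂ)) := by
      ext U
      simp only [toComplexCM_apply, reEntry_apply, ContinuousMap.smul_apply, ContinuousMap.add_apply,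
        ContinuousMap.star_apply, entryC_apply, smul_eq_mul, Complex.re_eq_add_conj, Complex.star_def]
      ring
    rw [SetLike.mem_coe, Subalgebra.mem_comap, Subalgebra.mem_restrictScalars, e1]
    exact Subalgebra.smul_mem _ (Subalgebra.add_mem _ (hE e a b) (hS e a b)) _
  · have e1 : toComplexCM (imEntry r e a b) =
        ((-(Complex.I / 2)) • (entryC r e a b - star (entryC r e a b)) : C(GaugeConfig d L G, ℂ)) := by
      ext U
      simp only [toComplexCM_apply, imEntry_apply, ContinuousMap.smul_apply, ContinuousMap.sub_apply,
        ContinuousMap.star_apply, entryC_apply, smul_eq_mul, Complex.im_eq_sub_conj, Complex.star_def]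
      have hI : (2 * Complex.I) ≠ 0 := mul_ne_zero two_ne_zero Complex.I_ne_zero
      field_simp
      ring_nf
      rw [Complex.I_sq]
      ring
    rw [SetLike.mem_coe, Subalgebra.mem_comap, Subalgebra.mem_restrictScalars, e1]
    exact Subalgebra.smul_mem _ (Subalgebra.sub_mem _ (hE e a b) (hS e a b)) _

/-- ★ **Real and imaginary parts of multi-trace complex Wilson loops are real multi-trace Wilson
loops.** -/
theorem reCM_mem_loopAlgebra (x : Site d L) {F : C(GaugeConfig d L G, ℂ)}
    (hF : F ∈ loopAlgebraC (d := d) (L := L) r x) :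
    reCM F ∈ loopAlgebra (d := d) (L := L) r x ∧ imCM F ∈ loopAlgebra (d := d) (L := L) r x := by
  induction hF using Algebra.adjoin_induction with
  | mem F hF =>
    obtain ⟨w, hw, rfl⟩ := hF
    exact ⟨loopRe_mem_loopAlgebra r x hw, loopIm_mem_loopAlgebra r x hw⟩
  | algebraMap c =>
    refine ⟨?_, ?_⟩
    · have e : reCM (algebraMap ℂ C(GaugeConfig d L G, ℂ) c) = algebraMap ℝ C(GaugeConfig d L G, ℝ) c.re := by
        ext U; rfl
      rw [e]; exact Subalgebra.algebraMap_mem _ _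
    · have e : imCM (algebraMap ℂ C(GaugeConfig d L G, ℂ) c) = algebraMap ℝ C(GaugeConfig d L G, ℝ) c.im := by
        ext U; rfl
      rw [e]; exact Subalgebra.algebraMap_mem _ _
  | add F H _ _ ihF ihH =>
    refine ⟨?_, ?_⟩
    · have e : reCM (F + H) = reCM F + reCM H := by ext U; simp
      rw [e]; exact Subalgebra.add_mem _ ihF.1 ihH.1
    · have e : imCM (F + H) = imCM F + imCM H := by ext U; simp
      rw [e]; exact Subalgebra.add_mem _ ihF.2 ihH.2
  | mul F H _ _ ihF ihH =>
    refine ⟨?_, ?_⟩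
    · have e : reCM (F * H) = reCM F * reCM H - imCM F * imCM H := by ext U; simp [Complex.mul_re]
      rw [e]; exact Subalgebra.sub_mem _ (Subalgebra.mul_mem _ ihF.1 ihH.1) (Subalgebra.mul_mem _ ihF.2 ihH.2)
    · have e : imCM (F * H) = reCM F * imCM H + imCM F * reCM H := by ext U; simp [Complex.mul_im]
      rw [e]; exact Subalgebra.add_mem _ (Subalgebra.mul_mem _ ihF.1 ihH.2) (Subalgebra.mul_mem _ ihF.2 ihH.1)

/-! ## The first fundamental theorem -/

section FFT

variable [CompactSpace G] [MeasurableSpace G] [BorelSpace G] [SecondCountableTopology G] [NeZero L]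
variable {r}

/-- ★★★ **FIRST FUNDAMENTAL THEOREM FOR LATTICE GAUGE INVARIANTS**: on the torus `(ℤ/L)^d` with a
compact gauge group whose (unitary, faithful) image contains `SU(N)`, every gauge-invariant
polynomial observable in the link variables is a polynomial in the Wilson loops
`Re/Im tr ρ(hol_0 w)`, `w` closed at the base point (Durhuus 1980; Sengupta 1994; Weyl). -/
theorem mem_loopAlgebra_of_isGaugeInvariant (hSU : ContainsSU r) (hN : 0 < r.N)
    {f : C(GaugeConfig d L G, ℝ)} (hf : f ∈ polyAlgebra (ι := Edge d L) r) (hfi : IsGaugeInvariant (⇑f)) :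
    f ∈ loopAlgebra (d := d) (L := L) r 0 := by
  have hFi : IsGaugeInvariant (⇑(toComplexCM f)) := fun γ U => by
    simp only [toComplexCM_apply, hfi γ U]
  have h := (reCM_mem_loopAlgebra r 0
    (mem_loopAlgebraC_of_isGaugeInvariant hSU hN (toComplexCM_mem_polyAlgebraC r hf) hFi)).1
  rwa [reCM_toComplexCM] at h

/-- ★★★ **FFT, iff form**: a polynomial observable is gauge invariant iff it lies in the Wilson
loop algebra at the base point. -/
theorem isGaugeInvariant_iff_mem_loopAlgebra (hSU : ContainsSU r) (hN : 0 < r.N)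
    {f : C(GaugeConfig d L G, ℝ)} (hf : f ∈ polyAlgebra (ι := Edge d L) r) :
    IsGaugeInvariant (⇑f) ↔ f ∈ loopAlgebra (d := d) (L := L) r 0 :=
  ⟨mem_loopAlgebra_of_isGaugeInvariant hSU hN hf, fun h => (loopAlgebra_le r 0 h).2⟩

/-- ★★ **The gauge average of every polynomial observable is a polynomial in Wilson loops** (e.g.
the gauge average of a product of open Wilson lines — the entries of the Kazakov–Zheng positivity
matrices and the terms of their multi-trace loop equations). -/
theorem gaugeAvgL_mem_loopAlgebra (hSU : ContainsSU r) (hN : 0 < r.N)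
    {f : C(GaugeConfig d L G, ℝ)} (hf : f ∈ polyAlgebra (ι := Edge d L) r) :
    gaugeAvgL d L G f ∈ loopAlgebra (d := d) (L := L) r 0 :=
  mem_loopAlgebra_of_isGaugeInvariant hSU hN (gaugeAvgL_mem_polyAlgebra r hf) (isGaugeInvariant_gaugeAvgL f)

/-- ★★★ `SU(N)`, defining representation: gauge-invariant polynomial observables = the Wilson loop
algebra. -/
theorem isGaugeInvariant_iff_mem_loopAlgebra_suN (N : ℕ) (hN : 0 < N)
    {f : C(GaugeConfig d L (Matrix.specialUnitaryGroup (Fin N) ℂ), ℝ)}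
    (hf : f ∈ polyAlgebra (ι := Edge d L) (fundamentalLatticeRep N)) :
    IsGaugeInvariant (⇑f) ↔ f ∈ loopAlgebra (d := d) (L := L) (fundamentalLatticeRep N) 0 :=
  isGaugeInvariant_iff_mem_loopAlgebra (containsSU_suN N) hN hf

/-- ★★★ `U(N)`, defining representation: gauge-invariant polynomial observables = the Wilson loop
algebra. -/
theorem isGaugeInvariant_iff_mem_loopAlgebra_uN (N : ℕ) (hN : 0 < N)
    {f : C(GaugeConfig d L (Matrix.unitaryGroup (Fin N) ℂ), ℝ)}
    (hf : f ∈ polyAlgebra (ι := Edge d L) (unitaryFundamentalLatticeRep N)) :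
    IsGaugeInvariant (⇑f) ↔ f ∈ loopAlgebra (d := d) (L := L) (unitaryFundamentalLatticeRep N) 0 :=
  isGaugeInvariant_iff_mem_loopAlgebra (containsSU_uN N) hN hf

end FFT

/-! ## Base points, and single traces for `SU(2)` -/

section BasePoint

variable [NeZero L]

omit [IsTopologicalGroup G] in
/-- Moving the base point: `tr ρ(hol_y w) = tr ρ(hol_0(p · w · p̄))`, `p` a path from `0` to `y`. -/
theorem trace_rho_wordHolonomy_conj_basePath (U : GaugeConfig d L G) (y : Site d L) {w : Word d}
    (hw : Word.endpoint y w = y) :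
    (r.ρ (wordHolonomy U 0 (basePath y ++ w ++ (basePath y).reverse))).trace =
      (r.ρ (wordHolonomy U y w)).trace := by
  rw [wordHolonomy_append, wordHolonomy_append, Word.endpoint_append, endpoint_basePath, hw,
    wordHolonomy_reverse_of_endpoint U (endpoint_basePath y), map_mul, map_mul, Matrix.trace_mul_cycle,
    ← map_mul, inv_mul_cancel, map_one, Matrix.one_mul]

/-- The conjugated word is closed at `0`. -/
theorem endpoint_conj_basePath (y : Site d L) {w : Word d} (hw : Word.endpoint y w = y) :
    Word.endpoint (0 : Site d L) (basePath y ++ w ++ (basePath y).reverse) = 0 := by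
  rw [Word.endpoint_append, Word.endpoint_append, endpoint_basePath, hw]
  have h := Word.endpoint_reverse (0 : Site d L) (basePath y)
  rwa [endpoint_basePath] at h

/-- ★★ **The base point is immaterial**: the Wilson loop algebra at `0` is the algebra generated by
ALL Wilson loops (all base points) — the lane's `allLoops`. -/
theorem loopAlgebra_eq_adjoin_allLoops :
    loopAlgebra (d := d) (L := L) r 0 = Algebra.adjoin ℝ (allLoops (d := d) (L := L) r) := by
  refine le_antisymm (Algebra.adjoin_mono ?_) (Algebra.adjoin_le ?_)
  · rintro f ⟨w, hw, hf⟩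
    exact ⟨0, w, hw, hf⟩
  · rintro f ⟨y, w, hw, rfl | rfl⟩
    · have e : loopRe r y w = loopRe r 0 (basePath y ++ w ++ (basePath y).reverse) := by
        ext U; rw [loopRe_apply, loopRe_apply, trace_rho_wordHolonomy_conj_basePath r U y hw]
      rw [SetLike.mem_coe, e]
      exact loopRe_mem_loopAlgebra r 0 (endpoint_conj_basePath y hw)
    · have e : loopIm r y w = loopIm r 0 (basePath y ++ w ++ (basePath y).reverse) := by
        ext U; rw [loopIm_apply, loopIm_apply, trace_rho_wordHolonomy_conj_basePath r U y hw]
      rw [SetLike.mem_coe, e]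
      exact loopIm_mem_loopAlgebra r 0 (endpoint_conj_basePath y hw)

/-- ★★★ **`SU(2)`: SINGLE-TRACE WILSON LOOPS DETERMINE EVERY GAUGE-INVARIANT POLYNOMIAL
OBSERVABLE**: two linear functionals on the observables which agree on `1` and on the single
Wilson loops `Re tr hol_x(w)` at one base point agree on every gauge-invariant polynomial
observable (FFT + the `SU(2)` trace identity, `eqOn_adjoin_loops_of_eqOn_single_su2`). -/
theorem eq_of_eqOn_singleLoops_su2 (x : Site d L)
    {φ ψ : C(GaugeConfig d L (Matrix.specialUnitaryGroup (Fin 2) ℂ), ℝ) →ₗ[ℝ] ℝ} (h1 : φ 1 = ψ 1)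
    (hloops : ∀ w : Word d, Word.endpoint x w = x →
      φ (loopRe (fundamentalLatticeRep 2) x w) = ψ (loopRe (fundamentalLatticeRep 2) x w))
    {f : C(GaugeConfig d L (Matrix.specialUnitaryGroup (Fin 2) ℂ), ℝ)}
    (hf : f ∈ polyAlgebra (ι := Edge d L) (fundamentalLatticeRep 2)) (hfi : IsGaugeInvariant (⇑f)) :
    φ f = ψ f := by
  have h := mem_loopAlgebra_of_isGaugeInvariant (containsSU_suN 2) (by norm_num) hf hfi
  rw [loopAlgebra_eq_adjoin_allLoops] at h
  exact eqOn_adjoin_loops_of_eqOn_single_su2 x h1 hloops h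

end BasePoint

end Summit.QuantumFields.GaugeBoot

end
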